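import Mathlib.Algebra.Algebra.Rat
import Mathlib.Algebra.Polynomial.Div
import Mathlib.Algebra.Polynomial.AlgebraMap
import Mathlib.Data.Real.Basic
import Mathlib.Tactic.Ring

/-!
# `NormalFormPrinciple` (stmt-KontsevichZagierPeriods-3869), stub `exists_peel_pole` —
# the explicit / elementary route (siege attempt k6)

One peeling step of the partial-fraction expansion of `p/q` (`p, q ∈ ℚ[X]`) at a rational root `ρ`
of `q`:
`p/q = c/(t − ρ)^{k+1} + p₁/q₁` wherever `q(t) ≠ 0`, with `q₁` a non-zero proper divisor of `q`.

This file proves the registered stub signature `exists_peel_pole` **without root multiplicities**: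
only the factor theorem `q(ρ) = 0 ↔ q = (X − ρ)·(q /ₘ (X − ρ))` is used, one linear factor at a
time, by induction on `deg q`.

* *Simple step* (`peel_simple_identity`): if `q = (X − ρ) q'` with `q'(ρ) ≠ 0`, put
  `c := p(ρ)/q'(ρ)`; then `p − c·q'` vanishes at `ρ`, so `p − c·q' = (X − ρ) p₁`, and
  `p/q = c/(t − ρ) + p₁/q'` off the zeros of `q` (`k = 0`, `q₁ = q'`).
* *Lifting step* (`peel_lift_identity`): if `q = (X − ρ) q'` with `q'(ρ) = 0` and, inductively,
  `p/q' = c/(t − ρ)^{k+1} + p₁/q₁` off the zeros of `q'` (`q₁ ∣ q'` proper), then dividing by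
  `t − ρ` gives `p/q = c/(t − ρ)^{k+2} + p₁/((X − ρ) q₁)` off the zeros of `q`, and `(X − ρ) q₁` is
  a proper divisor of `q`.

Sources: M. Kontsevich, D. Zagier, *Periods* (2001), §1.2 (elementary reductions of one-variable
periods); the algebra is the textbook partial-fraction peeling. No definitions are introduced; the
namespace is private to this attempt (the tree's `…PiBox.Dlog.exists_peel_pole` is a different proof
via `rootMultiplicity`).
-/

noncomputable section

open scoped Polynomial

namespace Summit.KontsevichZagierPeriods.HurwitzMicroSectors.NormalFormPrinciple.PeelPoleElementaryK6

/-- Evaluation of a linear factor over `ℝ`: `aeval t ((X − C ρ) * r) = (t − ρ) * aeval t r`.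
[folklore] -/
theorem aeval_X_sub_C_mul (ρ : ℚ) (r : ℚ[X]) (t : ℝ) :
    (Polynomial.aeval t ((Polynomial.X - Polynomial.C ρ) * r) : ℝ) =
      (t - ρ) * Polynomial.aeval t r := by
  simp only [map_mul, map_sub, Polynomial.aeval_X, Polynomial.aeval_C, eq_ratCast]

/-- **Simple step.** If `q = (X − ρ) q'` and `c q' + (X − ρ) p₁ = p` (as polynomials over `ℚ`),
then `p/q = c/(t − ρ) + p₁/q'` at every real `t` with `q(t) ≠ 0`. [folklore] -/
theorem peel_simple_identity {p q q' p₁ : ℚ[X]} {ρ c : ℚ}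
    (hq : (Polynomial.X - Polynomial.C ρ) * q' = q)
    (hp : Polynomial.C c * q' + (Polynomial.X - Polynomial.C ρ) * p₁ = p)
    (t : ℝ) (ht : (Polynomial.aeval t q : ℝ) ≠ 0) :
    (Polynomial.aeval t p : ℝ) / Polynomial.aeval t q =
      (c:ℝ) / (t - ρ) ^ (0 + 1) + (Polynomial.aeval t p₁ : ℝ) / Polynomial.aeval t q' := by
  have hqt : (Polynomial.aeval t q : ℝ) = (t - ρ) * Polynomial.aeval t q' := by
    rw [← hq, aeval_X_sub_C_mul]
  have hpt : (Polynomial.aeval t p : ℝ) =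
      c * Polynomial.aeval t q' + (t - ρ) * Polynomial.aeval t p₁ := by
    rw [← hp, map_add, aeval_X_sub_C_mul, map_mul, Polynomial.aeval_C, eq_ratCast]
  have htρ : (t:ℝ) - ρ ≠ 0 := by
    intro h
    apply ht
    rw [hqt, h, zero_mul]
  have hq't : (Polynomial.aeval t q' : ℝ) ≠ 0 := by
    intro h
    apply ht
    rw [hqt, h, mul_zero]
  rw [hqt, hpt, zero_add, pow_one, add_div, mul_div_mul_right _ _ hq't, mul_div_mul_left _ _ htρ]

/-- **Lifting step.** If `q = (X − ρ) q'` and `p/q' = c/(t − ρ)^{k+1} + p₁/q₁` wherever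
`q'(t) ≠ 0`, then `p/q = c/(t − ρ)^{k+2} + p₁/((X − ρ) q₁)(t)` wherever `q(t) ≠ 0`. [folklore] -/
theorem peel_lift_identity {p q q' p₁ q₁ : ℚ[X]} {ρ c : ℚ} {k : ℕ}
    (hq : (Polynomial.X - Polynomial.C ρ) * q' = q)
    (hid : ∀ t : ℝ, (Polynomial.aeval t q' : ℝ) ≠ 0 →
      (Polynomial.aeval t p : ℝ) / Polynomial.aeval t q' =
        (c:ℝ) / (t - ρ) ^ (k + 1) + (Polynomial.aeval t p₁ : ℝ) / Polynomial.aeval t q₁)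
    (t : ℝ) (ht : (Polynomial.aeval t q : ℝ) ≠ 0) :
    (Polynomial.aeval t p : ℝ) / Polynomial.aeval t q =
      (c:ℝ) / (t - ρ) ^ (k + 1 + 1) +
        (Polynomial.aeval t p₁ : ℝ) /
          Polynomial.aeval t ((Polynomial.X - Polynomial.C ρ) * q₁) := by
  have hqt : (Polynomial.aeval t q : ℝ) = (t - ρ) * Polynomial.aeval t q' := by
    rw [← hq, aeval_X_sub_C_mul]
  have htρ : (t:ℝ) - ρ ≠ 0 := by
    intro h
    apply ht
    rw [hqt, h, zero_mul]
  have hq't : (Polynomial.aeval t q' : ℝ) ≠ 0 := by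
    intro h
    apply ht
    rw [hqt, h, mul_zero]
  have key : (Polynomial.aeval t p : ℝ) / Polynomial.aeval t q =
      (t - ρ)⁻¹ * ((Polynomial.aeval t p : ℝ) / Polynomial.aeval t q') := by
    rw [hqt, div_mul_eq_div_div, div_eq_inv_mul _ ((t:ℝ) - ρ), mul_div_assoc]
  rw [key, hid t hq't, aeval_X_sub_C_mul, mul_add, pow_succ _ (k + 1)]
  congr 1
  · rw [div_eq_inv_mul, div_eq_inv_mul, mul_inv, ← mul_assoc, mul_comm ((t:ℝ) - ρ)⁻¹]
  · rw [div_eq_inv_mul, div_eq_inv_mul, mul_inv, ← mul_assoc]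

/-- **Peeling a rational pole (explicit / elementary route).** If `q(ρ) = 0` (`ρ ∈ ℚ`, `q ≠ 0`)
then there are `k ∈ ℕ`, `c ∈ ℚ` and `p₁, q₁ ∈ ℚ[X]` with `q₁ ≠ 0`, `deg q₁ < deg q`, `q₁ ∣ q` and
`p/q = c/(t − ρ)^{k+1} + p₁/q₁` at every real `t` with `q(t) ≠ 0`. Proof by induction on `deg q`,
peeling one linear factor `X − ρ` at a time (`peel_simple_identity`, `peel_lift_identity`); no root
multiplicities are used. This is the registered sub-goal `exists_peel_pole` of crux
stmt-KontsevichZagierPeriods-3869, verbatim signature. [folklore] -/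
theorem exists_peel_pole (p q : ℚ[X]) (hq : q ≠ 0) {ρ : ℚ} (hρ : q.IsRoot ρ) :
    ∃ (k : ℕ) (c : ℚ) (p₁ q₁ : ℚ[X]), q₁ ≠ 0 ∧ q₁.natDegree < q.natDegree ∧ q₁ ∣ q ∧
      ∀ t : ℝ, (Polynomial.aeval t q : ℝ) ≠ 0 →
        (Polynomial.aeval t p : ℝ) / Polynomial.aeval t q =
          (c:ℝ) / (t - ρ) ^ (k + 1) + (Polynomial.aeval t p₁ : ℝ) / Polynomial.aeval t q₁ := by
  -- induction on an upper bound `n` of `deg q`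
  suffices H : ∀ (n : ℕ) (q : ℚ[X]), q.natDegree ≤ n → q ≠ 0 → q.IsRoot ρ →
      ∃ (k : ℕ) (c : ℚ) (p₁ q₁ : ℚ[X]), q₁ ≠ 0 ∧ q₁.natDegree < q.natDegree ∧ q₁ ∣ q ∧
        ∀ t : ℝ, (Polynomial.aeval t q : ℝ) ≠ 0 →
          (Polynomial.aeval t p : ℝ) / Polynomial.aeval t q =
            (c:ℝ) / (t - ρ) ^ (k + 1) + (Polynomial.aeval t p₁ : ℝ) / Polynomial.aeval t q₁ from
    H q.natDegree q le_rfl hq hρ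
  intro n
  induction n with
  | zero =>
    -- a non-zero constant has no root
    intro q hn hq hρ
    exfalso
    have hpos : 0 < q.natDegree :=
      Polynomial.natDegree_pos_iff_degree_pos.mpr (Polynomial.degree_pos_of_root hq hρ)
    omega
  | succ n ih =>
    intro q hn hq hρ
    -- one linear factor: `q = (X − ρ) q'`
    set q' : ℚ[X] := q /ₘ (Polynomial.X - Polynomial.C ρ) with hq'def
    have hfac : (Polynomial.X - Polynomial.C ρ) * q' = q :=
      Polynomial.mul_divByMonic_eq_iff_isRoot.mpr hρ
    have hXne : (Polynomial.X - Polynomial.C ρ : ℚ[X]) ≠ 0 := Polynomial.X_sub_C_ne_zero ρ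
    have hq'0 : q' ≠ 0 := by
      intro h
      apply hq
      rw [← hfac, h, mul_zero]
    have hdeg : q.natDegree = q'.natDegree + 1 := by
      conv_lhs => rw [← hfac]
      rw [Polynomial.natDegree_mul hXne hq'0, Polynomial.natDegree_X_sub_C, add_comm]
    by_cases hρ' : q'.IsRoot ρ
    · -- multiple root: peel `p/q'` inductively, then divide by `t − ρ`
      obtain ⟨k, c, p₁, q₁, hq₁0, hq₁deg, hq₁dvd, hid⟩ := ih q' (by omega) hq'0 hρ'
      refine ⟨k + 1, c, p₁, (Polynomial.X - Polynomial.C ρ) * q₁, mul_ne_zero hXne hq₁0, ?_,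
        ?_, fun t ht => peel_lift_identity hfac hid t ht⟩
      · rw [Polynomial.natDegree_mul hXne hq₁0, Polynomial.natDegree_X_sub_C, hdeg]
        omega
      · rw [← hfac]
        exact mul_dvd_mul_left _ hq₁dvd
    · -- simple root of `q/(X − ρ)^0 = q` relative to `q'`: `k = 0`, `q₁ = q'`
      have hq'ρ : q'.eval ρ ≠ 0 := hρ'
      set c : ℚ := p.eval ρ / q'.eval ρ with hc
      have hroot : (p - Polynomial.C c * q').IsRoot ρ := by
        rw [Polynomial.IsRoot.def, Polynomial.eval_sub, Polynomial.eval_mul, Polynomial.eval_C, hc,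
          div_mul_cancel₀ _ hq'ρ, sub_self]
      set p₁ : ℚ[X] := (p - Polynomial.C c * q') /ₘ (Polynomial.X - Polynomial.C ρ) with hp₁
      have hp₁' : (Polynomial.X - Polynomial.C ρ) * p₁ = p - Polynomial.C c * q' :=
        Polynomial.mul_divByMonic_eq_iff_isRoot.mpr hroot
      have hp : Polynomial.C c * q' + (Polynomial.X - Polynomial.C ρ) * p₁ = p := by
        rw [hp₁']; ring
      refine ⟨0, c, p₁, q', hq'0, by omega, ⟨Polynomial.X - Polynomial.C ρ, ?_⟩,
        fun t ht => peel_simple_identity hfac hp t ht⟩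
      rw [mul_comm, hfac]

end Summit.KontsevichZagierPeriods.HurwitzMicroSectors.NormalFormPrinciple.PeelPoleElementaryK6
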